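import Mathlib
import HarnessLib
import Summits.AtomisticToContinuum.BoseEinsteinCondensation.Theses.BECBathMassLiouville

/-!
# Birth skeleton (BC3) for crux `SpaceTimeLiouville` (stmt-AtomisticToContinuum-13801)

Route `BECBathMassLiouville` (sub-problem `BoseEinsteinCondensation`), crux rank 2, THE ENGINE:
for every repulsive finite-range `v`, the static-response body `SRBAt v` (finite compressibility at
every wavelength, energy currency) implies the insertion-residue body `ResidueAt v`
(`|⟨φ₀ ⊗ Θ, Ψ⟩|² ≥ c` between `δ`-near-minimisers `Θ` (`N` bodies) and `Ψ` (`N+1` bodies) on the torus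
of side `L = ((N+1)/ρ)^{1/3}`, `δ` chosen after `N`).

## The cut (three named stubs, composition `SpaceTimeLiouville_of` sorry-free)

Write `u(x) = ∫_{cell^N} conj Θ(X) Ψ(x, X) dX` for the CONDITIONAL INSERTION PROFILE of the pair
`(Θ, Ψ)` (the partial inner product over the bath). The residue of the crux is `L⁻³ |∫_cell u|²`; the
BATH FIDELITY is `Φ = ∫_cell |u|² = ⟨Ψ, (𝟙 ⊗ |Θ⟩⟨Θ|) Ψ⟩ ≤ 1`. Cauchy–Schwarz gives
`L⁻³|∫u|² ≤ Φ`; the crux needs the reverse direction, which splits into two genuinely different facts: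

* `stub_bathFidelity` (IR, the load-bearing stub = the card's LargeScaleFlatness in fidelity form):
  from the static response bound `SRBAt v` (the `H₋₁` input, consumed by time-averaging à la
  Kipnis–Varadhan) and the chemical-potential bound `ChemicalPotentialAt v` (the a-priori tagged kinetic
  budget `E|∇_y h|² ≤ μ_N E h²` with `μ_N ≤ Cρa`), NO ORTHOGONALITY CATASTROPHE in the bath sector:
  `Φ ≥ c` with ONE `c > 0` for all `ρ < ρ₀(v)` and all large `N` (Bogoliubov: `1 − O(√(ρa³))`).
* `stub_chemicalPotential` (UV, the card's HealingScaleDefect in energy currency): on the torus of side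
  `((N+1)/ρ)^{1/3}`, `E₀^per(N+1) ≤ E₀^per(N) + C ρ a` for all large `N` — Dyson's nearest-particle
  Jastrow insertion `F = f(min_j |y − x_j|)` against an `N`-body near-minimiser renormalises the bare
  (possibly hard-core) coupling to the scattering length (`8πρa(1+o(1))`); for integrable `v` it follows
  from the landed Born bound `periodicGroundStateEnergy_succ_le_add_born` with `C = ∫v / a`.
* `stub_profileFlatness` (symmetry seam): the profile of near-minimisers is asymptotically FLAT,
  `(1 − ε) ∫_cell |u|² ≤ L⁻³ |∫_cell u|²` (`ε > 0`, `δ` after `N, ε`): for the exact torus ground states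
  `u` is constant by the diagonal translation invariance of the unique positive (Perron–Frobenius)
  ground rays of `H_N` and `H_{N+1}`; near-minimisers inherit it by the fixed-`N` spectral gap
  (compactness), which is why `δ` is chosen after `N` (Disproof §7 of the sibling crux CorrectorClosure:
  an `N`-uniform window is FALSE already at `v = 0`).

`SpaceTimeLiouville_of : stub₁-sig → stub₂-sig → stub₃-sig → SpaceTimeLiouville` (hypotheses keyed by the
registered stub names `__Registered.stub_…`, conclusion the route decl by name) is a real proof
(merge the density thresholds, the eventual `N`, the windows `δ = min δ₁ δ₂`, take `ε = 1/2`, and chain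
`ofReal (c/2) = ofReal (1/2) · ofReal c ≤ ofReal (1/2) · Φ ≤ L⁻³ |overlap|²` in `ℝ≥0∞`).

Disproof used (sibling crux `Cruxes/CorrectorClosure/Disproof.lean`, same insertion target): §7 window
after `N` (all three stubs), §8 no constant above `1` (`c`, `1 − ε` are `≤ 1`-type), §10 diluteness is
load-bearing (every stub carries `∃ ρ₀, ∀ ρ < ρ₀`: hard spheres jam), §16 shared hidden input for
`⊤`-valued `v` (simplicity of the fixed-`N` hard-core torus ground state) sits in `stub_profileFlatness`.
-/

noncomputable section

namespace Summit.AtomisticToContinuum.BoseEinsteinCondensation.Cruxes.SpaceTimeLiouville.Birth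

open scoped BigOperators ENNReal NNReal ComplexConjugate
open MeasureTheory Filter
open Literature.MathematicalPhysics.QuantumManyBody.BoseGas
open Summit.AtomisticToContinuum.BoseEinsteinCondensation.Theses.BECBathMassLiouville (SpaceTimeLiouville)

/-! ## The bodies of the crux at a fixed potential (verbatim sub-terms of the route decl) -/

/-- The hypothesis of the crux at `v`: the body of `StaticResponseBound` (item 12057) — for
`ρ < ρ₀`, every `N`, `k ≠ 0`, `t` and every finite-energy periodic trial state,
`E₀^per(N,L) − C t² N / max(ρa, |p|²) ≤ ⟨Ψ, (H_N + t Σⱼ cos(p·xⱼ)) Ψ⟩`, `L = (N/ρ)^{1/3}`. [folklore] -/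
abbrev SRBAt (v : ℝ → ℝ≥0∞) : Prop :=
  ∃ ρ₀ : ℝ, 0 < ρ₀ ∧ ∃ C : ℝ, 0 < C ∧ ∀ ρ : ℝ, 0 < ρ → ρ < ρ₀ → ∀ N : ℕ, ∀ k : Fin 3 → ℤ, k ≠ 0 →
    ∀ t : ℝ, ∀ Ψ : PeriodicTrialState N (sideLength ρ N), periodicEnergy v Ψ ≠ ⊤ →
      (periodicGroundStateEnergy v N (sideLength ρ N)).toReal -
          C * t ^ 2 * N / max (ρ * (scatteringLength v).toReal)
            ((2 * Real.pi / sideLength ρ N) ^ 2 * ∑ i, (k i : ℝ) ^ 2) ≤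
        (periodicEnergy v Ψ).toReal +
          t * ∫ X in cellN N (sideLength ρ N),
            (∑ j, Real.cos (2 * Real.pi / sideLength ρ N * ∑ i, (k i : ℝ) * X j i)) * ‖Ψ.ψ X‖ ^ 2

/-- The conclusion of the crux at `v`: the body of the target `InsertionResidue` (item 13800) —
`L⁻³ |∫ conj Θ(X) ∫ Ψ(x,X) dx dX|² ≥ c` for `δ`-near-minimisers, `δ` after `N`. [folklore] -/
abbrev ResidueAt (v : ℝ → ℝ≥0∞) : Prop :=
  ∃ ρ₀ : ℝ, 0 < ρ₀ ∧ ∀ ρ : ℝ, 0 < ρ → ρ < ρ₀ → ∃ c : ℝ, 0 < c ∧ ∀ᶠ N : ℕ in Filter.atTop,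
    ∃ δ : ENNReal, 0 < δ ∧ ∀ Θ : PeriodicTrialState N (sideLength ρ (N + 1)),
      ∀ Ψ : PeriodicTrialState (N + 1) (sideLength ρ (N + 1)),
        periodicEnergy v Θ ≤ periodicGroundStateEnergy v N (sideLength ρ (N + 1)) + δ →
        periodicEnergy v Ψ ≤ periodicGroundStateEnergy v (N + 1) (sideLength ρ (N + 1)) + δ →
          ENNReal.ofReal c ≤
            ENNReal.ofReal ((sideLength ρ (N + 1) ^ 3)⁻¹) *
              (‖∫ X in cellN N (sideLength ρ (N + 1)),
                  conj (Θ.ψ X) * ∫ x in cell (sideLength ρ (N + 1)), Ψ.ψ (Matrix.vecCons x X)‖₊ : ENNReal) ^ 2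

/-- Read-back: the crux is literally `∀ v admissible, SRBAt v → ResidueAt v`. [folklore] -/
theorem spaceTimeLiouville_iff :
    SpaceTimeLiouville ↔ ∀ v : ℝ → ℝ≥0∞, IsRepulsiveFiniteRange v → SRBAt v → ResidueAt v :=
  Iff.rfl

/-! ## The three intermediate statements of the line -/

/-- **Chemical-potential bound (UV; HealingScaleDefect in energy currency).** On the torus of side
`L = ((N+1)/ρ)^{1/3}` the energy to add one boson is `O(ρa)`:
`E₀^per(N+1, L) ≤ E₀^per(N, L) + C ρ a`, one `C` for all `ρ < ρ₀(v)` and all large `N`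
(`a` = scattering length; Bogoliubov/Dyson: `μ = 8πρa(1 + O(√(ρa³)))`). [folklore] -/
abbrev ChemicalPotentialAt (v : ℝ → ℝ≥0∞) : Prop :=
  ∃ ρ₀ : ℝ, 0 < ρ₀ ∧ ∃ C : ℝ, 0 < C ∧ ∀ ρ : ℝ, 0 < ρ → ρ < ρ₀ → ∀ᶠ N : ℕ in Filter.atTop,
    periodicGroundStateEnergy v (N + 1) (sideLength ρ (N + 1)) ≤
      periodicGroundStateEnergy v N (sideLength ρ (N + 1)) +
        ENNReal.ofReal (C * ρ * (scatteringLength v).toReal)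

/-- **Bath fidelity (IR; no orthogonality catastrophe in the bath sector).** With
`u(x) = ∫_{cell^N} conj Θ(X) Ψ(x,X) dX`, the fidelity `Φ = ∫_cell |u|² = ⟨Ψ, (𝟙 ⊗ |Θ⟩⟨Θ|) Ψ⟩` of
`δ`-near-minimisers is bounded below by ONE constant: `Φ ≥ c > 0` for all `ρ < ρ₀(v)`, all large `N`,
`δ` after `N`. [folklore] -/
abbrev BathFidelityAt (v : ℝ → ℝ≥0∞) : Prop :=
  ∃ ρ₀ : ℝ, 0 < ρ₀ ∧ ∃ c : ℝ, 0 < c ∧ ∀ ρ : ℝ, 0 < ρ → ρ < ρ₀ → ∀ᶠ N : ℕ in Filter.atTop,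
    ∃ δ : ENNReal, 0 < δ ∧ ∀ Θ : PeriodicTrialState N (sideLength ρ (N + 1)),
      ∀ Ψ : PeriodicTrialState (N + 1) (sideLength ρ (N + 1)),
        periodicEnergy v Θ ≤ periodicGroundStateEnergy v N (sideLength ρ (N + 1)) + δ →
        periodicEnergy v Ψ ≤ periodicGroundStateEnergy v (N + 1) (sideLength ρ (N + 1)) + δ →
          ENNReal.ofReal c ≤
            ∫⁻ x in cell (sideLength ρ (N + 1)),
              (‖∫ X in cellN N (sideLength ρ (N + 1)), conj (Θ.ψ X) * Ψ.ψ (Matrix.vecCons x X)‖₊ : ENNReal) ^ 2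

/-- **Profile flatness (symmetry seam).** The conditional insertion profile of `δ`-near-minimisers is
asymptotically flat: `(1 − ε) ∫_cell |u|² ≤ L⁻³ |∫_{cell^N} conj Θ ∫_cell Ψ|²` for every `ε > 0`,
all large `N`, `δ` after `N, ε` (Cauchy–Schwarz gives the reverse inequality with `ε = 0`; for exact
ground states `u` is constant by translation invariance). [folklore] -/
abbrev ProfileFlatAt (v : ℝ → ℝ≥0∞) : Prop :=
  ∃ ρ₀ : ℝ, 0 < ρ₀ ∧ ∀ ρ : ℝ, 0 < ρ → ρ < ρ₀ → ∀ ε : ℝ, 0 < ε → ∀ᶠ N : ℕ in Filter.atTop,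
    ∃ δ : ENNReal, 0 < δ ∧ ∀ Θ : PeriodicTrialState N (sideLength ρ (N + 1)),
      ∀ Ψ : PeriodicTrialState (N + 1) (sideLength ρ (N + 1)),
        periodicEnergy v Θ ≤ periodicGroundStateEnergy v N (sideLength ρ (N + 1)) + δ →
        periodicEnergy v Ψ ≤ periodicGroundStateEnergy v (N + 1) (sideLength ρ (N + 1)) + δ →
          ENNReal.ofReal (1 - ε) *
              ∫⁻ x in cell (sideLength ρ (N + 1)),
                (‖∫ X in cellN N (sideLength ρ (N + 1)), conj (Θ.ψ X) * Ψ.ψ (Matrix.vecCons x X)‖₊ : ENNReal) ^ 2 ≤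
            ENNReal.ofReal ((sideLength ρ (N + 1) ^ 3)⁻¹) *
              (‖∫ X in cellN N (sideLength ρ (N + 1)),
                  conj (Θ.ψ X) * ∫ x in cell (sideLength ρ (N + 1)), Ψ.ψ (Matrix.vecCons x X)‖₊ : ENNReal) ^ 2

/-! ## The three named statements of the line (skeleton vocabulary) -/

/-- **Named statement of Stub 1**: the chemical-potential bound for every admissible potential. [folklore] -/
def ChemicalPotentialBound : Prop :=
  ∀ v : ℝ → ℝ≥0∞, IsRepulsiveFiniteRange v → ChemicalPotentialAt v

/-- **Named statement of Stub 2** (the heart): UV budget and static response give uniform bath fidelity. [folklore] -/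
def BathFidelityOfResponse : Prop :=
  ∀ v : ℝ → ℝ≥0∞, IsRepulsiveFiniteRange v → ChemicalPotentialAt v → SRBAt v → BathFidelityAt v

/-- **Named statement of Stub 3**: asymptotic flatness of the conditional insertion profile. [folklore] -/
def ProfileFlatness : Prop :=
  ∀ v : ℝ → ℝ≥0∞, IsRepulsiveFiniteRange v → ProfileFlatAt v

/-! ## Stubs (the open lemmas of the line; `sorry` only here)

Each stub is stated over TREE VOCABULARY ONLY (the bodies above written out; `open
Literature.MathematicalPhysics.QuantumManyBody.BoseGas` for the short names), so that it lands verbatim as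
`Theorems/BECBathMassLiouvilleSpaceTimeLiouville<Stub>.lean --supports stmt-AtomisticToContinuum-13801` without
importing this workfile; the `*_holds` theorems below certify definitionally that the written-out text IS the named
statement. -/

/-- **Stub 1 — `stub_chemicalPotential` (UV renormalisation; size M, L for hard cores).** For every
repulsive finite-range `v`: `ChemicalPotentialAt v`. Why plausibly true: insert one particle into an
`N`-body `δ'`-near-minimiser `Θ` with Dyson's nearest-particle Jastrow factor `F(y,X) = f(min_j |y−x_j|)`
(`f` the truncated zero-energy scattering solution, `f ≡ 1` beyond `b`, `a ≪ b ≪ (ρa)^{-1/2}`): the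
ground-state substitution `∫|∇_X(FΘ)|² + V_N F²|Θ|² = Re q_N(F²Θ, Θ) + ∫|∇_X F|²|Θ|²` and
`|f'(t_min)|² ≤ Σ_j |f'(|y−x_j|)|²`, `Σ_j v(y−x_j) f(t_min)² ≤ Σ_j (v f²)(|y−x_j|)` (monotone `f`) bound
the excess by `N L⁻³ ∫(2f'² + v f²) ≤ 8πρa(1 + O(a/b))` over a norm `≥ 1 − Cρab²`, with the slack of
`Θ` sent to `0` first (fixed `N`). For `∫ v < ∞` it is the landed Born bound
`HealingScaleKacInsertion.periodicGroundStateEnergy_succ_le_add_born` (`μ ≤ N L⁻³ ∫_cell v^per ≤ ρ ∫ v`,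
`C = ∫v/a` when `a > 0`; `a = 0` forces `v = 0` a.e. and both sides vanish). Why it might fail: only
through the `C¹` trial class (the min-Jastrow factor is Lipschitz: mollify) — no mechanism-level doubt.
Leans on: `LSSY2005_upperBound_periodic` technology (LSSY2005 Thm 2.2 (2.14) and its proof), `scatteringLength_le`.
[cite: LSSY2005, Thm 2.2 (2.14); Dyson1957] -/
theorem stub_chemicalPotential :
    ∀ v : ℝ → ℝ≥0∞, IsRepulsiveFiniteRange v →
      ∃ ρ₀ : ℝ, 0 < ρ₀ ∧ ∃ C : ℝ, 0 < C ∧ ∀ ρ : ℝ, 0 < ρ → ρ < ρ₀ → ∀ᶠ N : ℕ in Filter.atTop,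
        periodicGroundStateEnergy v (N + 1) (sideLength ρ (N + 1)) ≤
          periodicGroundStateEnergy v N (sideLength ρ (N + 1)) +
            ENNReal.ofReal (C * ρ * (scatteringLength v).toReal) := by
  sorry

/-- **Stub 2 — `stub_bathFidelity` (THE HEART; size: open-problem).** For every repulsive finite-range
`v`: `ChemicalPotentialAt v → SRBAt v → BathFidelityAt v`. Intended proof (card L1): for the torus
ground states, `h = Ψ_{N+1}/Ψ_N > 0` solves `(−G_N − Δ_y + Σ_j v^per(y − x_j)) h = μ_N h` over the
`|Ψ_N|²`-stationary bath diffusion `G_N`; the fidelity is `Φ = L³ (E h)²`-normalised flatness of `h` in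
`L²(|Ψ_N|² dX ⊗ dy)`. A-priori input: `E|∇_y h|² ≤ μ_N E h²` with `μ_N ≤ Cρa` (Stub 1), so all tagged
kinetic energy sits at scales `≲ ξ = (8πρa)^{-1/2}`; above `ξ` the variance of the block potential
time-averaged over `ℓ²` is `≤ (2/ℓ²) m₋₁` (Kipnis–Varadhan), and `m₋₁(block density) ≤ C N/max(ρa, p²)`
IS `SRBAt v` (second-order energy response, optimised in `t`): ellipticity defect
`g²(ℓ) ≍ a²ρ ℓ⁻¹`, summable in dyadic `ℓ ≥ ξ`, `≍ √(ρa³)` at `ℓ = ξ` ⇒ corrector bounded in `L²` ⇒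
`Φ ≥ 1 − C'√(ρa³) ≥ c` uniformly in `ρ < ρ₀`; near-minimisers by the fixed-`N` gap (`δ` after `N`).
One-loop calibration: `1 − Φ = (1/V²) Σ_q |v̂_q|² Σ_n |⟨n|ρ_q|0⟩|²/(ω_n + q²)² ≤ (1/V²)Σ_q v̂_q² m₋₁(q)/q²
= O(√(ρa³))` — IR-finite in `d = 3` exactly because of recoil + `m₋₁` (static `S(q)/q⁴` alone is
log-divergent; the frozen bath `∫S/q⁴` power-divergent: FrozenBathNoBEC). Why it might fail: `SRBAt v`
bounds only `H₋₁` norms of LINEAR density modes; quenched large-scale regularity wants rated decorrelation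
of all coarse-grained functionals of a walker-independent medium (AKM2019, GGM2022), and `|Ψ_N|²` is
gapless and reacts to the walker. Not cheaply the crux: different functional (`∫|u|²`, not
`L⁻³|∫u|²`), extra UV hypothesis, `c` uniform in `ρ`. Leans on: `GroundStateDirichletForm`,
`PeriodicFeynmanKac*`, `RemovalEnergyBudget` (sibling crux), Kipnis–Varadhan.
[cite: KipnisVaradhan1986; ArmstrongBordasMourrat2018; GiuntiGuMourrat2022; LSSY2005, Ch. 5] -/
theorem stub_bathFidelity :
    ∀ v : ℝ → ℝ≥0∞, IsRepulsiveFiniteRange v →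
      (∃ ρ₀ : ℝ, 0 < ρ₀ ∧ ∃ C : ℝ, 0 < C ∧ ∀ ρ : ℝ, 0 < ρ → ρ < ρ₀ → ∀ᶠ N : ℕ in Filter.atTop,
          periodicGroundStateEnergy v (N + 1) (sideLength ρ (N + 1)) ≤
            periodicGroundStateEnergy v N (sideLength ρ (N + 1)) +
              ENNReal.ofReal (C * ρ * (scatteringLength v).toReal)) →
      (∃ ρ₀ : ℝ, 0 < ρ₀ ∧ ∃ C : ℝ, 0 < C ∧ ∀ ρ : ℝ, 0 < ρ → ρ < ρ₀ → ∀ N : ℕ, ∀ k : Fin 3 → ℤ, k ≠ 0 →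
          ∀ t : ℝ, ∀ Ψ : PeriodicTrialState N (sideLength ρ N), periodicEnergy v Ψ ≠ ⊤ →
            (periodicGroundStateEnergy v N (sideLength ρ N)).toReal -
                C * t ^ 2 * N / max (ρ * (scatteringLength v).toReal)
                  ((2 * Real.pi / sideLength ρ N) ^ 2 * ∑ i, (k i : ℝ) ^ 2) ≤
              (periodicEnergy v Ψ).toReal +
                t * ∫ X in cellN N (sideLength ρ N),
                  (∑ j, Real.cos (2 * Real.pi / sideLength ρ N * ∑ i, (k i : ℝ) * X j i)) * ‖Ψ.ψ X‖ ^ 2) →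
        ∃ ρ₀ : ℝ, 0 < ρ₀ ∧ ∃ c : ℝ, 0 < c ∧ ∀ ρ : ℝ, 0 < ρ → ρ < ρ₀ → ∀ᶠ N : ℕ in Filter.atTop,
          ∃ δ : ENNReal, 0 < δ ∧ ∀ Θ : PeriodicTrialState N (sideLength ρ (N + 1)),
            ∀ Ψ : PeriodicTrialState (N + 1) (sideLength ρ (N + 1)),
              periodicEnergy v Θ ≤ periodicGroundStateEnergy v N (sideLength ρ (N + 1)) + δ →
              periodicEnergy v Ψ ≤ periodicGroundStateEnergy v (N + 1) (sideLength ρ (N + 1)) + δ →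
                ENNReal.ofReal c ≤
                  ∫⁻ x in cell (sideLength ρ (N + 1)),
                    (‖∫ X in cellN N (sideLength ρ (N + 1)), conj (Θ.ψ X) * Ψ.ψ (Matrix.vecCons x X)‖₊ : ENNReal) ^ 2 := by
  sorry

/-- **Stub 3 — `stub_profileFlatness` (symmetry seam; size M–L, Lean-heavy).** For every repulsive
finite-range `v`: `ProfileFlatAt v`. Why plausibly true: at `ρ < ρ₀(v)` the torus energies are finite
(LSSY upper bound) and the `N`- and `(N+1)`-body torus ground rays are unique and positive
(Perron–Frobenius in the Feynman–Kac picture, `PeriodicFeynmanKacPerronFrobenius`,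
`PeriodicGroundStateNondegenerate`), hence invariant under the diagonal translations `X ↦ X + s𝟙`, so
`u(x + s) = u(x)`: `u` is constant and `(∫|u|²) L³ = |∫u|²` exactly; near-minimisers converge to the
ground rays as `δ → 0` at fixed `N` (compact resolvent ⇒ gap), `(Θ, Ψ) ↦ u` is `1`-Lipschitz into
`L²(cell)` and both sides are phase-free, giving the `(1 − ε)` version with `δ = δ(N, ε)`. Contains the
Fubini identity `∫_cell u = ∫_{cell^N} conj Θ ∫_cell Ψ` (cf. `ResidueCondensesAll_proof`). Why it might
fail: for `⊤`-valued `v` the simplicity of the fixed-`N` hard-core torus ground state (connectivity of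
the dilute hard-sphere configuration space at fixed packing fraction) is open in print
(Baryshnikov–Bubenik–Kahle 2014 §6) — the shared hidden input of every insertion line (CorrectorClosure
Disproof §16); for bounded `v` no doubt. [cite: ReedSimonIV1978, §XIII.12; LSSY2005, Thm 2.2 (2.14)] -/
theorem stub_profileFlatness :
    ∀ v : ℝ → ℝ≥0∞, IsRepulsiveFiniteRange v →
      ∃ ρ₀ : ℝ, 0 < ρ₀ ∧ ∀ ρ : ℝ, 0 < ρ → ρ < ρ₀ → ∀ ε : ℝ, 0 < ε → ∀ᶠ N : ℕ in Filter.atTop,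
        ∃ δ : ENNReal, 0 < δ ∧ ∀ Θ : PeriodicTrialState N (sideLength ρ (N + 1)),
          ∀ Ψ : PeriodicTrialState (N + 1) (sideLength ρ (N + 1)),
            periodicEnergy v Θ ≤ periodicGroundStateEnergy v N (sideLength ρ (N + 1)) + δ →
            periodicEnergy v Ψ ≤ periodicGroundStateEnergy v (N + 1) (sideLength ρ (N + 1)) + δ →
              ENNReal.ofReal (1 - ε) *
                  ∫⁻ x in cell (sideLength ρ (N + 1)),
                    (‖∫ X in cellN N (sideLength ρ (N + 1)), conj (Θ.ψ X) * Ψ.ψ (Matrix.vecCons x X)‖₊ : ENNReal) ^ 2 ≤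
                ENNReal.ofReal ((sideLength ρ (N + 1) ^ 3)⁻¹) *
                  (‖∫ X in cellN N (sideLength ρ (N + 1)),
                      conj (Θ.ψ X) * ∫ x in cell (sideLength ρ (N + 1)), Ψ.ψ (Matrix.vecCons x X)‖₊ : ENNReal) ^ 2 := by
  sorry

/-! ## Consistency: each named statement IS its stub (definitionally) -/

theorem chemicalPotentialBound_holds : ChemicalPotentialBound := stub_chemicalPotential
theorem bathFidelityOfResponse_holds : BathFidelityOfResponse := stub_bathFidelity
theorem profileFlatness_holds : ProfileFlatness := stub_profileFlatness

/-! ## Registered-name aliases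

The skeleton audit (`ledger skeleton check`, A12) admits a hypothesis of the skeleton theorem only when its head
constant is a registered obligation or is NAMED like a declared stub; `__Registered.stub_X` is the statement of
`stub_X` under that name (device of `Cruxes/*/Lines/birth.lean` elsewhere in the tree; the `@[stub]` attribute is
gate-reserved). Each alias is `rfl`-equal to its statement. -/
namespace __Registered

/-- Alias of `ChemicalPotentialBound` keyed by the registered stub name. -/
abbrev stub_chemicalPotential : Prop := ChemicalPotentialBound
/-- Alias of `BathFidelityOfResponse` keyed by the registered stub name. -/
abbrev stub_bathFidelity : Prop := BathFidelityOfResponse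
/-- Alias of `ProfileFlatness` keyed by the registered stub name. -/
abbrev stub_profileFlatness : Prop := ProfileFlatness

end __Registered

/-! ## Composition (sorry-free) -/

/-- **Fidelity × flatness ⇒ residue** at a fixed potential: merge the density thresholds, the
eventual `N` and the windows (`δ = min δ₁ δ₂`), take `ε = 1/2`, and chain
`ofReal (c/2) = ofReal (1/2)·ofReal c ≤ ofReal (1/2)·Φ ≤ L⁻³|overlap|²`. [folklore] -/
theorem residueAt_of_fidelity_of_flat (v : ℝ → ℝ≥0∞) (hfid : BathFidelityAt v)
    (hflat : ProfileFlatAt v) : ResidueAt v := by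
  obtain ⟨ρ₁, hρ₁, c, hc, H1⟩ := hfid
  obtain ⟨ρ₂, hρ₂, H2⟩ := hflat
  refine ⟨min ρ₁ ρ₂, lt_min hρ₁ hρ₂, fun ρ hρ hρlt => ⟨c / 2, half_pos hc, ?_⟩⟩
  have h1 := H1 ρ hρ (hρlt.trans_le (min_le_left _ _))
  have h2 := H2 ρ hρ (hρlt.trans_le (min_le_right _ _)) (1 / 2) one_half_pos
  filter_upwards [h1, h2] with N hN1 hN2
  obtain ⟨δ₁, hδ₁, G1⟩ := hN1
  obtain ⟨δ₂, hδ₂, G2⟩ := hN2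
  refine ⟨min δ₁ δ₂, lt_min hδ₁ hδ₂, fun Θ Ψ hΘ hΨ => ?_⟩
  have g1 := G1 Θ Ψ (hΘ.trans (add_le_add le_rfl (min_le_left δ₁ δ₂)))
    (hΨ.trans (add_le_add le_rfl (min_le_left δ₁ δ₂)))
  have g2 := G2 Θ Ψ (hΘ.trans (add_le_add le_rfl (min_le_right δ₁ δ₂)))
    (hΨ.trans (add_le_add le_rfl (min_le_right δ₁ δ₂)))
  calc ENNReal.ofReal (c / 2)
      = ENNReal.ofReal (1 - 1 / 2) * ENNReal.ofReal c := by
        rw [← ENNReal.ofReal_mul (by norm_num)]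
        congr 1
        ring
    _ ≤ _ := mul_le_mul' le_rfl g1
    _ ≤ _ := g2

/-- **The crux from the three stubs, BY NAME** (no `sorry` of its own, none inherited: the stubs enter
as hypotheses under their registered names; axioms propext / Classical.choice / Quot.sound). [folklore] -/
theorem SpaceTimeLiouville_of (h₁ : __Registered.stub_chemicalPotential)
    (h₂ : __Registered.stub_bathFidelity) (h₃ : __Registered.stub_profileFlatness) : SpaceTimeLiouville :=
  fun v hv hK => residueAt_of_fidelity_of_flat v (h₂ v hv (h₁ v hv) hK) (h₃ v hv)

/-- Wiring check (an `example`, so that `SpaceTimeLiouville_of` stays the only theorem concluding the crux): the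
stubs, with their written-out tree-vocabulary types, feed the skeleton theorem as stated — this term becomes the
crux proof when the three `sorry`s above are discharged. -/
example : SpaceTimeLiouville :=
  SpaceTimeLiouville_of stub_chemicalPotential stub_bathFidelity stub_profileFlatness

end Summit.AtomisticToContinuum.BoseEinsteinCondensation.Cruxes.SpaceTimeLiouville.Birth

end
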